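/-
Copyright: cell `pub-ymgap` (HUMAN RULING D-0062), Track A of `YM-PLAN.md`, DAG node N20 (= NE7b); R134 seat `pub-ymgap-dag-n20-d`
(strategy s3 «alternative currency», generation 6), module 8.  Released under the licence of the surrounding project.
-/
import Summits.QuantumFields.YangMills.Theorems.BalabanUVNodesN20ByValueLadder
import Summits.QuantumFields.YangMills.Theorems.BalabanUVNodesN20ByValueTwoLevelMoment
import Summits.QuantumFields.YangMills.Theorems.BalabanUVNodesN20LCSAvgCellPeierls
import HarnessLib

/-!
# YM-DAG node N20 (= NE7b), strategy s3, THE FOURTH CURRENCY «BY VALUE» (module 8, an INSTANCE): PEIERLS PER CELL AT EVERY LEVEL and the JOINT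
# SPARSENESS OF ANY TWO LEVELS — the (JS) letters the label tower of record asks for a key pinned at ANY ONE level `k`, and at any PAIR of levels

Track A of `YM-PLAN.md` (cell `pub-ymgap`, HUMAN RULING D-0062), node **N20** = spine estimate NE7b (`T4WeightBudget.RelWeightBound` — the cell
`pub-balaban`'s OWN estimate, NOT PRINTED in [Bałaban 1983–89], NOT PROVED).  Seat `pub-ymgap-dag-n20-d` (R134, s3), generation 6, module 8 (after the
fourth-currency package p496513 · p497227 · p498565 · p500598 · p501576, the two-level instance p502557 and the ladder p504356).  Kernel theorems only:
0 `def`, 0 `sorry`, standard axioms; COUNT-NEUTRAL (`--supports` K3⁗ `SpineGivenEndpointR13Sep`, stmt-QuantumFields-20292, `--as helper`).  Restate-immune.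

THE POINT.  In the fourth currency the per-class residual of NE7b on a MODULE tower is ONE joint-sparseness inequality (JS) for the pinned large-field
events of ALL pinned levels, read on Bałaban's iterated block averages `Ū^k = Averaging.iter (fun _ => blockAvg expMeanLogSU) k U` under the level-0 state
(modules 2 ∕ 3 ∕ 5).  Seat `pub-ymgap-dag-n20-c`'s LABEL TOWER OF RECORD (its modules 27–28) pins, for a label `(P,Q,R,S)_{k+1}` containing a χ-cube `c`, the
event «some plaquette `p′ ∈ R(c)` of the `(k+1)`-fold average is large, `ε″ ≤ |Ū^{k+1}(∂p′) − 1|`» — a ONE-WITNESS-PER-CELL event of the `(k+1)`-fold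
average.  Module 7 typed Peierls at every level for a PRESCRIBED set of large plaquettes (energy currency); this file supplies the forms the label tower
consumes:
* §1 ★ `gibbsMeasure_largeField_dist1_iterAvgFun_le` — Peierls at every level `k` in the SIZE currency `|Ū^k(∂p) − 1| ≥ ε` (threshold `ε²∕(2N)`,
  generation 3's `sq_div_le_one_sub_reTr_of_le_dist1`).
* §2 ★★ `gibbsMeasure_largeFieldCells_iterAvgFun_le` ∕ `gibbsMeasure_largeFieldCells_dist1_iterAvgFun_le` — ONE WITNESS PER CELL AT EVERY LEVEL `k`:
  for a finite family `𝒞` of cells with pairwise disjoint witness sets of `≤ m` level-`k` plaquettes,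
  `μ_β{U | ∀ c ∈ 𝒞, ∃ p ∈ cells c, ε ≤ |Ū^k(∂p) − 1|} ≤ (m·e^{C_kδ_k − δ_kβε²∕(2N)})^{#𝒞}` (generation 3's counting `measureReal_forall_exists_le_pow` over
  module 7's ladder) — the (JS) letter of a key pinned at ANY ONE level, INHABITED (level 1 = generation 3's `gibbsMeasure_largeFieldCells_dist1_avgFun_le`,
  the letter n20-c's first-step modules 19 ∕ 23 consume).
* §3 ★★ `jointExpMoment_iterAvgFun_pair` ∕ ★ `gibbsMeasure_jointLargeField_iterAvgFun_le` — (JM) and joint sparseness at ANY TWO levels `k₁, k₂`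
  (Cauchy–Schwarz on two rungs of the ladder at doubled tilt; module 6 = the pair `{0, 1}`), and the `ρ₀·dU` shape `jointMoment_boltzmann_iterAvgFun_pair`
  modules 2 ∕ 5 consume.

HONEST FRAMING.  An INSTANCE with LETTER-BASED, LEVEL-DEPENDENT constants (module 7's `δ_k`, `C_k`); the pair bound halves the admissible tilt (Cauchy–Schwarz)
— `n` pinned levels by the same device divide it by `n`: NOTHING here is uniform along a renewal chain; the located wall of NE7b in the fourth currency
(level-uniform joint moments = Bałaban's inductive small-field analysis, print's KIND [Balaban1989LargeFieldII] (1.79) p. 383, NOT print's statement) is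
untouched.  Nothing of Bałaban's is asserted; NE7b NOT PRINTED ∕ NOT PROVED; the (α)-instance 0∕1; N20 NOT discharged (typed 28∕28, discharged count
untouched); one finite four-torus programme at fixed `ε` — NOT ℝ⁴, NOT infinite volume, NOT OS, NOT a mass gap, NOT Clay.  References (LOCATORS only; no
decl carries a cite tag): T. Bałaban, CMP **109** (1987) [Balaban1987RG1] ((0.4), (0.11) p. 253: the iterated averages; (0.13)–(0.15) p. 254: the
small-field conditions in the size currency); CMP **122** (1989) 175–202 [Balaban1989LargeFieldI] ((0.1) p. 175: the `p₀(g)` extraction per large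
plaquette); CMP **122** (1989) 355–392 [Balaban1989LargeFieldII] ((1.79) p. 383).
-/

set_option autoImplicit false

noncomputable section

open scoped BigOperators Matrix.Norms.L2Operator
open MeasureTheory
open Literature.MathematicalPhysics.QuantumFieldTheory.Balaban1983to89
open T4Continuum T4ReflectionCone BlockAveraging ExpMeanLog
open Summit.QuantumFields.YangMills.BalabanUVNodes.N20ByValueLadder
open Summit.QuantumFields.YangMills.BalabanUVNodes.N20ByValueTwoLevelMoment (rpow_half_integral_sq_exp_le measureReal_and_le_of_jointMoment)
open Summit.QuantumFields.YangMills.BalabanUVNodes.N20LCSAvgCellPeierls (measureReal_forall_exists_le_pow exp_mul_card_eq_pow)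
open Summit.QuantumFields.YangMills.BalabanUVNodes.N20LCSAvgExpMoment (sq_div_le_one_sub_reTr_of_le_dist1)
open Summit.QuantumFields.YangMills.BalabanUVNodes.N20LCSCoarseSparseness (measureReal_forall_le_le_of_expMoment)

namespace Summit.QuantumFields.YangMills.BalabanUVNodes.N20ByValueLadderCells

variable {N : ℕ} [NeZero N]

/-! ## §1 Peierls at every level in the size currency -/

section PeierlsDist

/-- **LARGE-FIELD SPARSENESS AT EVERY LEVEL, IN THE SIZE CURRENCY** `|Ū^k(∂p) − 1| ≥ ε` of [Balaban1987RG1]'s small-field conditions: with the `δ_k > 0`,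
`C_k ≥ 0` of module 7's `localExpMoment_iterAvgFun`, for every `d = 4` parameter set `P` (`P.L = L`, `k ≤ m + K`), every `β ≥ 4N`, every `ε ≥ 0` and every
finite set `Y` of level-`k` plaquettes,
  `μ_β{U | ∀ p ∈ Y, ε ≤ |Ū^k(∂p) − 1|} ≤ e^{C_k δ_k #Y}·e^{−δ_k β (ε²∕(2N)) #Y}`
— the size event lies in module 7's energy event at threshold `ε²∕(2N)` (`sq_div_le_one_sub_reTr_of_le_dist1`). [folklore] -/
theorem gibbsMeasure_largeField_dist1_iterAvgFun_le (N : ℕ) [NeZero N] (L k : ℕ) :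
    ∃ δ₀ : ℝ, 0 < δ₀ ∧ ∃ C : ℝ, 0 ≤ C ∧ ∀ (P : Params), P.d = 4 → P.L = L → k ≤ P.m + P.K →
      ∀ (β : ℝ), 4 * N ≤ β → ∀ (ε : ℝ), 0 ≤ ε → ∀ (Y : Finset (Plaq P k)),
        (T4GenFunBounds.gibbsMeasure P β : Measure (GaugeField P 0 (Matrix.specialUnitaryGroup (Fin N) ℂ))).real
            {U | ∀ p ∈ Y, ε ≤ dist1 (GaugeField.plaqHol
              (Averaging.iter (fun _ => blockAvg (expMeanLogSU (n := Fin N))) k U) p)} ≤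
          Real.exp (C * δ₀ * Y.card) * Real.exp (-(δ₀ * β * (ε ^ 2 / (2 * (Fintype.card (Fin N) : ℝ))) * Y.card)) := by
  obtain ⟨δ₀, hδ₀, C, hC, h⟩ := gibbsMeasure_largeField_iterAvgFun_le N L k
  refine ⟨δ₀, hδ₀, C, hC, fun P hd hL hmK β hβ ε hε Y => ?_⟩
  have hNpos : (0 : ℝ) < N := Nat.cast_pos.mpr (Nat.pos_of_ne_zero (NeZero.ne N))
  have hβ0 : 0 ≤ β := le_trans (by positivity) hβ
  haveI := T4GenFunBounds.isProbabilityMeasure_gibbsMeasure (G := Matrix.specialUnitaryGroup (Fin N) ℂ) P hβ0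
  have hsub : {U : GaugeField P 0 (Matrix.specialUnitaryGroup (Fin N) ℂ) |
        ∀ p ∈ Y, ε ≤ dist1 (GaugeField.plaqHol (Averaging.iter (fun _ => blockAvg (expMeanLogSU (n := Fin N))) k U) p)} ⊆
      {U | ∀ p ∈ Y, ε ^ 2 / (2 * (Fintype.card (Fin N) : ℝ)) ≤
        1 - reTr (GaugeField.plaqHol (Averaging.iter (fun _ => blockAvg (expMeanLogSU (n := Fin N))) k U) p)} :=
    fun U hU p hp => sq_div_le_one_sub_reTr_of_le_dist1 _ hε (hU p hp)
  exact (measureReal_mono hsub).trans (h P hd hL hmK β hβ _ Y)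

end PeierlsDist

/-! ## §2 One witness per cell, at every level -/

section Cells

/-- **THE PEIERLS WEIGHT PER LARGE-FIELD CELL OF `Ū^k`, AT EVERY LEVEL `k`** (energy currency): with the `δ_k > 0`, `C_k ≥ 0` of module 7's
`localExpMoment_iterAvgFun`, for every `d = 4` parameter set `P` (`P.L = L`, `k ≤ m + K`), every `β ≥ 4N`, every threshold `ε`, every finite family `𝒞`
of cells with pairwise disjoint sets `cells c` of at most `m` level-`k` plaquettes,
  `μ_β{U | ∀ c ∈ 𝒞, ∃ p ∈ cells c, ε ≤ 1 − reTr Ū^k(∂p)} ≤ (m·e^{C_kδ_k − δ_kβε})^{#𝒞}`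
(generation 3's counting `measureReal_forall_exists_le_pow` over module 7's Peierls at level `k`). [folklore] -/
theorem gibbsMeasure_largeFieldCells_iterAvgFun_le (N : ℕ) [NeZero N] (L k : ℕ) :
    ∃ δ₀ : ℝ, 0 < δ₀ ∧ ∃ C : ℝ, 0 ≤ C ∧ ∀ (P : Params), P.d = 4 → P.L = L → k ≤ P.m + P.K →
      ∀ (β : ℝ), 4 * N ≤ β → ∀ (ε : ℝ) {κ : Type} [DecidableEq κ] (𝒞 : Finset κ) (cells : κ → Finset (Plaq P k)) (m : ℕ),
        (∀ c ∈ 𝒞, (cells c).card ≤ m) → (∀ c₁ ∈ 𝒞, ∀ c₂ ∈ 𝒞, c₁ ≠ c₂ → Disjoint (cells c₁) (cells c₂)) →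
        (T4GenFunBounds.gibbsMeasure P β : Measure (GaugeField P 0 (Matrix.specialUnitaryGroup (Fin N) ℂ))).real
            {U | ∀ c ∈ 𝒞, ∃ p ∈ cells c, ε ≤ 1 - reTr (GaugeField.plaqHol
              (Averaging.iter (fun _ => blockAvg (expMeanLogSU (n := Fin N))) k U) p)} ≤
          ((m : ℝ) * Real.exp (C * δ₀ - δ₀ * β * ε)) ^ 𝒞.card := by
  classical
  obtain ⟨δ₀, hδ₀, C, hC, h⟩ := gibbsMeasure_largeField_iterAvgFun_le N L k
  refine ⟨δ₀, hδ₀, C, hC, fun P hd hL hmK β hβ ε κ _ 𝒞 cells m hm hdisj => ?_⟩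
  have hNpos : (0 : ℝ) < N := Nat.cast_pos.mpr (Nat.pos_of_ne_zero (NeZero.ne N))
  have hβ0 : 0 ≤ β := le_trans (by positivity) hβ
  haveI := T4GenFunBounds.isProbabilityMeasure_gibbsMeasure (G := Matrix.specialUnitaryGroup (Fin N) ℂ) P hβ0
  refine measureReal_forall_exists_le_pow _
    (fun p => {U : GaugeField P 0 (Matrix.specialUnitaryGroup (Fin N) ℂ) |
      ε ≤ 1 - reTr (GaugeField.plaqHol (Averaging.iter (fun _ => blockAvg (expMeanLogSU (n := Fin N))) k U) p)})
    𝒞 cells hm hdisj (Real.exp_pos _).le fun Y => ?_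
  rw [← exp_mul_card_eq_pow]
  exact h P hd hL hmK β hβ ε Y

/-- **THE SAME IN THE SIZE CURRENCY, AT EVERY LEVEL `k`** (threshold `ε²∕(2N)`; `ε ≥ 0`):
  `μ_β{U | ∀ c ∈ 𝒞, ∃ p ∈ cells c, ε ≤ |Ū^k(∂p) − 1|} ≤ (m·e^{C_kδ_k − δ_kβ(ε²∕(2N))})^{#𝒞}`
— the (JS) letter of the fourth currency for a key of the label tower of record pinned at ANY ONE level, INHABITED with module 7's level-`k` constants
(level `1` = generation 3's `gibbsMeasure_largeFieldCells_dist1_avgFun_le`). [folklore] -/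
theorem gibbsMeasure_largeFieldCells_dist1_iterAvgFun_le (N : ℕ) [NeZero N] (L k : ℕ) :
    ∃ δ₀ : ℝ, 0 < δ₀ ∧ ∃ C : ℝ, 0 ≤ C ∧ ∀ (P : Params), P.d = 4 → P.L = L → k ≤ P.m + P.K →
      ∀ (β : ℝ), 4 * N ≤ β → ∀ (ε : ℝ), 0 ≤ ε → ∀ {κ : Type} [DecidableEq κ] (𝒞 : Finset κ) (cells : κ → Finset (Plaq P k)) (m : ℕ),
        (∀ c ∈ 𝒞, (cells c).card ≤ m) → (∀ c₁ ∈ 𝒞, ∀ c₂ ∈ 𝒞, c₁ ≠ c₂ → Disjoint (cells c₁) (cells c₂)) →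
        (T4GenFunBounds.gibbsMeasure P β : Measure (GaugeField P 0 (Matrix.specialUnitaryGroup (Fin N) ℂ))).real
            {U | ∀ c ∈ 𝒞, ∃ p ∈ cells c, ε ≤ dist1 (GaugeField.plaqHol
              (Averaging.iter (fun _ => blockAvg (expMeanLogSU (n := Fin N))) k U) p)} ≤
          ((m : ℝ) * Real.exp (C * δ₀ - δ₀ * β * (ε ^ 2 / (2 * (Fintype.card (Fin N) : ℝ))))) ^ 𝒞.card := by
  classical
  obtain ⟨δ₀, hδ₀, C, hC, h⟩ := gibbsMeasure_largeField_dist1_iterAvgFun_le N L k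
  refine ⟨δ₀, hδ₀, C, hC, fun P hd hL hmK β hβ ε hε κ _ 𝒞 cells m hm hdisj => ?_⟩
  have hNpos : (0 : ℝ) < N := Nat.cast_pos.mpr (Nat.pos_of_ne_zero (NeZero.ne N))
  have hβ0 : 0 ≤ β := le_trans (by positivity) hβ
  haveI := T4GenFunBounds.isProbabilityMeasure_gibbsMeasure (G := Matrix.specialUnitaryGroup (Fin N) ℂ) P hβ0
  refine measureReal_forall_exists_le_pow _
    (fun p => {U : GaugeField P 0 (Matrix.specialUnitaryGroup (Fin N) ℂ) |
      ε ≤ dist1 (GaugeField.plaqHol (Averaging.iter (fun _ => blockAvg (expMeanLogSU (n := Fin N))) k U) p)})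
    𝒞 cells hm hdisj (Real.exp_pos _).le fun Y => ?_
  rw [← exp_mul_card_eq_pow]
  exact h P hd hL hmK β hβ ε hε Y

end Cells

/-! ## §3 Any two levels: the joint exponential moment and joint sparseness -/

section Pair

/-- The level-`k` carrier composed with `Ū^k` is in `L²(μ_β)` (bounded on a probability space), `β ≥ 0`. [folklore] -/
theorem memLp_two_exp_plaqSum_iter (P : Params) {β : ℝ} (hβ : 0 ≤ β) (k : ℕ) (t : ℝ) (Q : Finset (Plaq P k)) :
    MemLp (fun U : GaugeField P 0 (Matrix.specialUnitaryGroup (Fin N) ℂ) =>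
        Real.exp (t * ∑ p ∈ Q, (1 - reTr (GaugeField.plaqHol
          (Averaging.iter (fun _ => blockAvg (expMeanLogSU (n := Fin N))) k U) p))))
      (ENNReal.ofReal 2) (T4GenFunBounds.gibbsMeasure P β : Measure (GaugeField P 0 (Matrix.specialUnitaryGroup (Fin N) ℂ))) := by
  haveI := T4GenFunBounds.isProbabilityMeasure_gibbsMeasure (G := Matrix.specialUnitaryGroup (Fin N) ℂ) P hβ
  refine MemLp.of_bound (measurable_exp_plaqSum_iter P k t Q).aestronglyMeasurable (Real.exp (|t| * (2 * Q.card)))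
    (ae_of_all _ fun U => ?_)
  rw [Real.norm_eq_abs]
  exact abs_exp_plaqSum_iter_le P k t Q U

/-- **(JM) AT ANY TWO LEVELS UNDER THE LEVEL-0 LATTICE YANG–MILLS STATE.**  For every `N ≥ 1`, `L`, `k₁`, `k₂` there are `δ₀ > 0` and `C₁, C₂ ≥ 0` such that
for every `d = 4` parameter set `P` (`P.L = L`, `k₁, k₂ ≤ m + K`), every `β ≥ 4N`, every `0 ≤ δ ≤ δ₀` and all finite sets `X` of level-`k₁` and `Q` of
level-`k₂` plaquettes,
  `∫ e^{δβ Σ_{q∈X}(1 − reTr Ū^{k₁}(∂q))} · e^{δβ Σ_{p∈Q}(1 − reTr Ū^{k₂}(∂p))} dμ_β ≤ e^{C₁δ#X + C₂δ#Q}`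
(Cauchy–Schwarz on module 7's rungs `k₁`, `k₂` at doubled tilt; `δ₀ = min(δ_{k₁}, δ_{k₂})∕2`; module 6 = the pair `{0, 1}`). [folklore] -/
theorem jointExpMoment_iterAvgFun_pair (N : ℕ) [NeZero N] (L k₁ k₂ : ℕ) :
    ∃ δ₀ : ℝ, 0 < δ₀ ∧ ∃ C₁ : ℝ, 0 ≤ C₁ ∧ ∃ C₂ : ℝ, 0 ≤ C₂ ∧ ∀ (P : Params), P.d = 4 → P.L = L → k₁ ≤ P.m + P.K → k₂ ≤ P.m + P.K →
      ∀ (β : ℝ), 4 * N ≤ β → ∀ (δ : ℝ), 0 ≤ δ → δ ≤ δ₀ → ∀ (X : Finset (Plaq P k₁)) (Q : Finset (Plaq P k₂)),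
        ∫ U, Real.exp (δ * β * ∑ q ∈ X, (1 - reTr (GaugeField.plaqHol
                (Averaging.iter (fun _ => blockAvg (expMeanLogSU (n := Fin N))) k₁ U) q))) *
              Real.exp (δ * β * ∑ p ∈ Q, (1 - reTr (GaugeField.plaqHol
                (Averaging.iter (fun _ => blockAvg (expMeanLogSU (n := Fin N))) k₂ U) p)))
            ∂(T4GenFunBounds.gibbsMeasure P β : Measure (GaugeField P 0 (Matrix.specialUnitaryGroup (Fin N) ℂ))) ≤
          Real.exp (C₁ * δ * X.card + C₂ * δ * Q.card) := by
  obtain ⟨δ₁, hδ₁, C₁, hC₁, h1⟩ := localExpMoment_iterAvgFun N L k₁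
  obtain ⟨δ₂, hδ₂, C₂, hC₂, h2⟩ := localExpMoment_iterAvgFun N L k₂
  refine ⟨min (δ₁ / 2) (δ₂ / 2), lt_min (half_pos hδ₁) (half_pos hδ₂), C₁, hC₁, C₂, hC₂,
    fun P hd hL hk₁ hk₂ β hβ δ hδ hδle X Q => ?_⟩
  have hNpos : (0 : ℝ) < N := Nat.cast_pos.mpr (Nat.pos_of_ne_zero (NeZero.ne N))
  have hβ0 : 0 ≤ β := le_trans (by positivity) hβ
  have h2δa : 2 * δ ≤ δ₁ := by linarith [hδle.trans (min_le_left _ _)]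
  have h2δb : 2 * δ ≤ δ₂ := by linarith [hδle.trans (min_le_right _ _)]
  have h2δ0 : 0 ≤ 2 * δ := by linarith
  set μ := (T4GenFunBounds.gibbsMeasure P β : Measure (GaugeField P 0 (Matrix.specialUnitaryGroup (Fin N) ℂ))) with hμ
  -- the two one-level moments at the doubled tilt
  have hm1 : ∫ U, Real.exp (2 * (δ * β * ∑ q ∈ X, (1 - reTr (GaugeField.plaqHol
      (Averaging.iter (fun _ => blockAvg (expMeanLogSU (n := Fin N))) k₁ U) q)))) ∂μ ≤ Real.exp (2 * (C₁ * δ * X.card)) := by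
    have h := h1 P hd hL hk₁ β hβ (2 * δ) h2δ0 h2δa X
    have e1 : (fun U : GaugeField P 0 (Matrix.specialUnitaryGroup (Fin N) ℂ) =>
        Real.exp (2 * (δ * β * ∑ q ∈ X, (1 - reTr (GaugeField.plaqHol
          (Averaging.iter (fun _ => blockAvg (expMeanLogSU (n := Fin N))) k₁ U) q))))) =
        fun U => Real.exp (2 * δ * β * ∑ q ∈ X, (1 - reTr (GaugeField.plaqHol
          (Averaging.iter (fun _ => blockAvg (expMeanLogSU (n := Fin N))) k₁ U) q))) := by
      funext U; ring_nf
    rw [e1, show 2 * (C₁ * δ * (X.card : ℝ)) = C₁ * (2 * δ) * X.card by ring]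
    exact h
  have hm2 : ∫ U, Real.exp (2 * (δ * β * ∑ p ∈ Q, (1 - reTr (GaugeField.plaqHol
      (Averaging.iter (fun _ => blockAvg (expMeanLogSU (n := Fin N))) k₂ U) p)))) ∂μ ≤ Real.exp (2 * (C₂ * δ * Q.card)) := by
    have h := h2 P hd hL hk₂ β hβ (2 * δ) h2δ0 h2δb Q
    have e1 : (fun U : GaugeField P 0 (Matrix.specialUnitaryGroup (Fin N) ℂ) =>
        Real.exp (2 * (δ * β * ∑ p ∈ Q, (1 - reTr (GaugeField.plaqHol
          (Averaging.iter (fun _ => blockAvg (expMeanLogSU (n := Fin N))) k₂ U) p))))) =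
        fun U => Real.exp (2 * δ * β * ∑ p ∈ Q, (1 - reTr (GaugeField.plaqHol
          (Averaging.iter (fun _ => blockAvg (expMeanLogSU (n := Fin N))) k₂ U) p))) := by
      funext U; ring_nf
    rw [e1, show 2 * (C₂ * δ * (Q.card : ℝ)) = C₂ * (2 * δ) * Q.card by ring]
    exact h
  -- Cauchy–Schwarz
  have hCS := integral_mul_le_Lp_mul_Lq_of_nonneg (μ := μ) Real.HolderConjugate.two_two
    (ae_of_all _ fun U => (Real.exp_pos _).le) (ae_of_all _ fun U => (Real.exp_pos _).le)
    (memLp_two_exp_plaqSum_iter P hβ0 k₁ (δ * β) X) (memLp_two_exp_plaqSum_iter P hβ0 k₂ (δ * β) Q)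
  refine hCS.trans ?_
  rw [show C₁ * δ * (X.card : ℝ) + C₂ * δ * Q.card = (C₁ * δ * X.card) + (C₂ * δ * Q.card) by ring, Real.exp_add]
  exact mul_le_mul (rpow_half_integral_sq_exp_le μ _ hm1) (rpow_half_integral_sq_exp_le μ _ hm2)
    (Real.rpow_nonneg (integral_nonneg fun U => Real.rpow_nonneg (Real.exp_pos _).le _) _) (Real.exp_pos _).le

/-- **JOINT LARGE-FIELD SPARSENESS OF ANY TWO LEVELS UNDER THE LEVEL-0 LATTICE YANG–MILLS STATE.**  With the `δ₀ > 0`, `C₁, C₂ ≥ 0` of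
`jointExpMoment_iterAvgFun_pair`: for every `d = 4` parameter set `P` (`P.L = L`, `k₁, k₂ ≤ m + K`), every `β ≥ 4N`, all thresholds `ε₁, ε₂` and all finite
sets `X` of level-`k₁` and `Q` of level-`k₂` plaquettes,
  `μ_β{U | (∀ q ∈ X, ε₁ ≤ 1 − reTr Ū^{k₁}(∂q)) ∧ ∀ p ∈ Q, ε₂ ≤ 1 − reTr Ū^{k₂}(∂p)} ≤ e^{C₁δ₀#X + C₂δ₀#Q} · e^{−δ₀β(ε₁#X + ε₂#Q)}`
— prescribed large plaquettes of the `k₁`-fold AND of the `k₂`-fold averaged field are JOINTLY rare, one Peierls factor per plaquette of either level: the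
two-level case of the (JS) letter the fourth currency asks along a genealogy pinned at the levels `{k₁, k₂}`. [folklore] -/
theorem gibbsMeasure_jointLargeField_iterAvgFun_le (N : ℕ) [NeZero N] (L k₁ k₂ : ℕ) :
    ∃ δ₀ : ℝ, 0 < δ₀ ∧ ∃ C₁ : ℝ, 0 ≤ C₁ ∧ ∃ C₂ : ℝ, 0 ≤ C₂ ∧ ∀ (P : Params), P.d = 4 → P.L = L → k₁ ≤ P.m + P.K → k₂ ≤ P.m + P.K →
      ∀ (β : ℝ), 4 * N ≤ β → ∀ (ε₁ ε₂ : ℝ) (X : Finset (Plaq P k₁)) (Q : Finset (Plaq P k₂)),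
        (T4GenFunBounds.gibbsMeasure P β : Measure (GaugeField P 0 (Matrix.specialUnitaryGroup (Fin N) ℂ))).real
            {U | (∀ q ∈ X, ε₁ ≤ 1 - reTr (GaugeField.plaqHol
                (Averaging.iter (fun _ => blockAvg (expMeanLogSU (n := Fin N))) k₁ U) q)) ∧
              ∀ p ∈ Q, ε₂ ≤ 1 - reTr (GaugeField.plaqHol
                (Averaging.iter (fun _ => blockAvg (expMeanLogSU (n := Fin N))) k₂ U) p)} ≤
          Real.exp (C₁ * δ₀ * X.card + C₂ * δ₀ * Q.card) * Real.exp (-(δ₀ * β * (ε₁ * X.card + ε₂ * Q.card))) := by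
  obtain ⟨δ₀, hδ₀, C₁, hC₁, C₂, hC₂, h⟩ := jointExpMoment_iterAvgFun_pair N L k₁ k₂
  refine ⟨δ₀, hδ₀, C₁, hC₁, C₂, hC₂, fun P hd hL hk₁ hk₂ β hβ ε₁ ε₂ X Q => ?_⟩
  have hNpos : (0 : ℝ) < N := Nat.cast_pos.mpr (Nat.pos_of_ne_zero (NeZero.ne N))
  have hβ0 : 0 ≤ β := le_trans (by positivity) hβ
  haveI := T4GenFunBounds.isProbabilityMeasure_gibbsMeasure (G := Matrix.specialUnitaryGroup (Fin N) ℂ) P hβ0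
  have hint : Integrable (fun U : GaugeField P 0 (Matrix.specialUnitaryGroup (Fin N) ℂ) =>
      Real.exp (δ₀ * β * ∑ q ∈ X, (1 - reTr (GaugeField.plaqHol
          (Averaging.iter (fun _ => blockAvg (expMeanLogSU (n := Fin N))) k₁ U) q))) *
        Real.exp (δ₀ * β * ∑ p ∈ Q, (1 - reTr (GaugeField.plaqHol
          (Averaging.iter (fun _ => blockAvg (expMeanLogSU (n := Fin N))) k₂ U) p))))
      (T4GenFunBounds.gibbsMeasure P β : Measure (GaugeField P 0 (Matrix.specialUnitaryGroup (Fin N) ℂ))) := by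
    refine (integrable_const (Real.exp (|δ₀ * β| * (2 * X.card)) * Real.exp (|δ₀ * β| * (2 * Q.card)))).mono'
      ((measurable_exp_plaqSum_iter P k₁ (δ₀ * β) X).mul (measurable_exp_plaqSum_iter P k₂ (δ₀ * β) Q)).aestronglyMeasurable
      (ae_of_all _ fun U => ?_)
    rw [Real.norm_eq_abs, abs_mul]
    exact mul_le_mul (abs_exp_plaqSum_iter_le P k₁ (δ₀ * β) X U) (abs_exp_plaqSum_iter_le P k₂ (δ₀ * β) Q U) (abs_nonneg _)
      (Real.exp_pos _).le
  have hmarkov := measureReal_and_le_of_jointMoment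
    (T4GenFunBounds.gibbsMeasure P β : Measure (GaugeField P 0 (Matrix.specialUnitaryGroup (Fin N) ℂ))) X Q
    (fun q U => 1 - reTr (GaugeField.plaqHol (Averaging.iter (fun _ => blockAvg (expMeanLogSU (n := Fin N))) k₁ U) q))
    (fun p U => 1 - reTr (GaugeField.plaqHol (Averaging.iter (fun _ => blockAvg (expMeanLogSU (n := Fin N))) k₂ U) p))
    (ε₀ := ε₁) (ε₁ := ε₂) hδ₀.le hβ0 hint
  exact hmarkov.trans (mul_le_mul_of_nonneg_right (h P hd hL hk₁ hk₂ β hβ δ₀ hδ₀.le le_rfl X Q) (Real.exp_pos _).le)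

/-- **(JM) AT ANY TWO LEVELS IN THE `ρ₀·dμ_0` SHAPE MODULES 2 ∕ 5 CONSUME** (`hJM` of `…N20ByValueExtraction.sum_admS_integral_le_of_jointMoment`; level-0 state
`e^{−βA}·dU`, `dU = fieldMeasure P 0 (SU N)`): with the constants of `jointExpMoment_iterAvgFun_pair`,
  `∫ (e^{δβ Σ_X(1 − reTr Ū^{k₁}(∂q))}·e^{δβ Σ_Q(1 − reTr Ū^{k₂}(∂p))})·e^{−βA(U)} dU ≤ e^{C₁δ#X + C₂δ#Q}·∫ e^{−βA(U)} dU`. [folklore] -/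
theorem jointMoment_boltzmann_iterAvgFun_pair (N : ℕ) [NeZero N] (L k₁ k₂ : ℕ) :
    ∃ δ₀ : ℝ, 0 < δ₀ ∧ ∃ C₁ : ℝ, 0 ≤ C₁ ∧ ∃ C₂ : ℝ, 0 ≤ C₂ ∧ ∀ (P : Params), P.d = 4 → P.L = L → k₁ ≤ P.m + P.K → k₂ ≤ P.m + P.K →
      ∀ (β : ℝ), 4 * N ≤ β → ∀ (δ : ℝ), 0 ≤ δ → δ ≤ δ₀ → ∀ (X : Finset (Plaq P k₁)) (Q : Finset (Plaq P k₂)),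
        ∫ U, (Real.exp (δ * β * ∑ q ∈ X, (1 - reTr (GaugeField.plaqHol
                (Averaging.iter (fun _ => blockAvg (expMeanLogSU (n := Fin N))) k₁ U) q))) *
              Real.exp (δ * β * ∑ p ∈ Q, (1 - reTr (GaugeField.plaqHol
                (Averaging.iter (fun _ => blockAvg (expMeanLogSU (n := Fin N))) k₂ U) p)))) *
            Missing.boltzmann P β U ∂fieldMeasure P 0 (Matrix.specialUnitaryGroup (Fin N) ℂ) ≤
          Real.exp (C₁ * δ * X.card + C₂ * δ * Q.card) *
            ∫ U, Missing.boltzmann P β U ∂fieldMeasure P 0 (Matrix.specialUnitaryGroup (Fin N) ℂ) := by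
  obtain ⟨δ₀, hδ₀, C₁, hC₁, C₂, hC₂, h⟩ := jointExpMoment_iterAvgFun_pair N L k₁ k₂
  refine ⟨δ₀, hδ₀, C₁, hC₁, C₂, hC₂, fun P hd hL hk₁ hk₂ β hβ δ hδ hδle X Q => ?_⟩
  have hNpos : (0 : ℝ) < N := Nat.cast_pos.mpr (Nat.pos_of_ne_zero (NeZero.ne N))
  have hβ0 : 0 ≤ β := le_trans (by positivity) hβ
  have hZ := Missing.partitionFn_pos' (G := Matrix.specialUnitaryGroup (Fin N) ℂ) P hβ0
  have hmain := h P hd hL hk₁ hk₂ β hβ δ hδ hδle X Q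
  rw [T4GenFunBounds.integral_gibbsMeasure P hβ0, div_le_iff₀ hZ] at hmain
  exact hmain

end Pair

end Summit.QuantumFields.YangMills.BalabanUVNodes.N20ByValueLadderCells

end
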